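import Literature.Probability.LatticeModels.AnnulusManeuver
import Literature.Probability.LatticeModels.KilledWalkLaplacian
import Literature.Probability.LatticeModels.DomainDiscretisation
import Literature.Topology.PlaneTopology.PlusCrossing
import Literature.Topology.PlaneTopology.JordanNesting
import HarnessLib

/-!
# The annulus maneuver for the edge-killed walk: one-scale weak Beurling at all scales

Topic `Literature/Probability/LatticeModels` (continuation of `AnnulusManeuver.lean`,
`ManeuverChain.lean`, `KilledWalkLaplacian.lean`). The one-scale weak Beurling estimate
(Smirnov 2010, Lemma B.2, after Kesten; Chelkak 2016, Lemma 2.11/2.13) for the **edge-killed**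
simple random walk `Ω^δ` of a planar domain — the walk on `δℤ²` that dies when it uses an edge
whose segment leaves `closure Ω` (`discreteDomainGraph`) — at **every** scale `k ≥ 1` (in lattice
units), not only at fixed continuum scales: if a boundary point of the Jordan domain `D` lies in
the (open) start box of radius `12k` about `c` (read on the mesh `δℤ²`), then from every site of that
box the edge-killed walk leaves the box of radius `48k` alive with probability at most
`1 - maneuverConst` (`JordanDomain.edgeKilled_survive_le`).

Proof, following `AnnulusManeuver.lean`: (II) the free chain `chainM ≥ c_*` on the start box
(imported); (III) **`M - Nᵉ ≤ 1 - survive`** for the edge-killed chain `chainNE`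
(`chainM_sub_chainNE_le`, maximum principle of `KilledWalkLaplacian`); (I) **`Nᵉ = 0`**: a
positive killed chain is witnessed by walks along kept edges (`exists_walk_of_killedHarmExt_pos`)
crossing the four frame strips (`exists_keptCrossings_of_chainNE_pos`); their planar traces
(`walkTrace`) lie in `closure D`, while an exterior point next to the boundary point escapes to
infinity through the (open, connected, unbounded) outside of the boundary loop, crossing one of
the strips transversally and hence meeting a trace in plus position
(`PlaneTopology.inter_nonempty_of_plus`) — a point of `closure D ∩ (closure D)ᶜ`
(`JordanDomain.false_of_keptCrossings`).

Everything is proved. [cite: Smirnov2010, Lemma B.2; Chelkak2016, Lemma 2.13]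
-/

noncomputable section

namespace Literature.Probability.LatticeModels

open Set SimpleGraph

/-! ### The edge-killed chain of a maneuver -/

section EdgeChain

variable (Gr : SimpleGraph (Site 2)) (U L : ℕ → Set (Site 2)) (n : ℕ)

open scoped Classical in
/-- **The edge-killed chain** `Nᵉ_j`: as `chainN`, with the walk killed when it uses a non-`Gr`
edge (`killedHarmExt` into `U i` of the data `1_{L i} Nᵉ_{j}`). [folklore] -/
def chainNE : ℕ → Site 2 → ℝ
  | 0 => fun _ => 1
  | j + 1 => killedHarmExt Gr (U (n - 1 - j)) fun w => if w ∈ L (n - 1 - j) then chainNE j w else 0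

/-- **Survival**: the probability of leaving `W` alive, `killedHarmExt Gr W 1`. [folklore] -/
def edgeSurvive (W : Set (Site 2)) : Site 2 → ℝ := killedHarmExt Gr W fun _ => 1

variable {Gr U L n}
variable (hU : ∀ i, (U i).Finite)

include hU in
/-- `0 ≤ Nᵉ_j ≤ 1`. [folklore] -/
theorem chainNE_mem_Icc (j : ℕ) (x : Site 2) : chainNE Gr U L n j x ∈ Icc (0 : ℝ) 1 := by
  classical
  induction j generalizing x with
  | zero => simp [chainNE]
  | succ j ih =>
    simp only [chainNE]
    exact ⟨killedHarmExt_nonneg (hU _) (fun w => by split_ifs <;> [exact (ih w).1; exact le_rfl]) x,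
      killedHarmExt_le' (hU _) zero_le_one (fun w => by split_ifs <;> [exact (ih w).2; exact zero_le_one]) x⟩

/-- `0 ≤ survive ≤ 1`. [folklore] -/
theorem edgeSurvive_mem_Icc {W : Set (Site 2)} (hW : W.Finite) (x : Site 2) : edgeSurvive Gr W x ∈ Icc (0 : ℝ) 1 :=
  ⟨killedHarmExt_nonneg hW (fun _ => zero_le_one) x, killedHarmExt_le' hW zero_le_one (fun _ => le_rfl) x⟩

/-- `survive = 1` off `W`. [folklore] -/
theorem edgeSurvive_of_not_mem {W : Set (Site 2)} {x : Site 2} (hx : x ∉ W) : edgeSurvive Gr W x = 1 :=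
  killedHarmExt_of_not_mem _ hx

/-- A lattice-harmonic function is the plain average of its four neighbours. [folklore] -/
theorem eq_avg_of_isLatticeHarmonicOn {h : Site 2 → ℝ} {S : Set (Site 2)} (H : IsLatticeHarmonicOn h S)
    {y : Site 2} (hy : y ∈ S) : h y = 4⁻¹ * ∑ e : SRW.Dir 2, h (y + SRW.stepVec e) := by
  have h0 := H y hy
  rw [latticeLaplacian_eq] at h0
  rw [sum_dir_eq_sum_cornerUnit (fun v => h (y + v))]
  linarith

include hU in
/-- **`M_j - Nᵉ_j ≤ 1 - survive` everywhere** (analytic strong Markov property for the edge-killed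
walk): the probability of performing the rest of the maneuver, minus that of performing it along
kept edges only, is at most the probability of dying before leaving `W` (only `U i ⊆ W` is needed).
[folklore] -/
theorem chainM_sub_chainNE_le {W : Set (Site 2)} (hW : W.Finite) (hUW : ∀ i, U i ⊆ W) (j : ℕ) (x : Site 2) :
    chainM U L n j x - chainNE Gr U L n j x ≤ 1 - edgeSurvive Gr W x := by
  classical
  induction j generalizing x with
  | zero => simp only [chainM, chainNE, sub_self]; linarith [(edgeSurvive_mem_Icc (Gr := Gr) hW x).2]
  | succ j ih =>
    set i := n - 1 - j with hi
    set gM : Site 2 → ℝ := fun w => if w ∈ L i then chainM U L n j w else 0 with hgM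
    set gN : Site 2 → ℝ := fun w => if w ∈ L i then chainNE Gr U L n j w else 0 with hgN
    have hM : chainM U L n (j + 1) = harmExt (U i) gM := rfl
    have hN : chainNE Gr U L n (j + 1) = killedHarmExt Gr (U i) gN := rfl
    have hs1 : ∀ y, edgeSurvive Gr W y ≤ 1 := fun y => (edgeSurvive_mem_Icc hW y).2
    have hM1 : ∀ y, chainM U L n (j + 1) y ≤ 1 := fun y => (chainM_mem_Icc hU (j + 1) y).2
    -- the claim off `U i`
    have hoff : ∀ y, y ∉ U i → chainM U L n (j + 1) y - chainNE Gr U L n (j + 1) y ≤ 1 - edgeSurvive Gr W y := by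
      intro y hy
      rw [hN, killedHarmExt_of_not_mem _ hy, hM, harmExt_of_not_mem (hU i) _ hy, hgM, hgN]
      simp only
      by_cases hyL : y ∈ L i
      · simp only [hyL, if_true]; exact ih y
      · simp only [hyL, if_false, sub_zero]; linarith [hs1 y]
    by_cases hx : x ∈ U i
    · -- inside: `F = M - Nᵉ - (1 - survive)` is killed-subharmonic on `U i`
      set F : Site 2 → ℝ := fun y => chainM U L n (j + 1) y - chainNE Gr U L n (j + 1) y - (1 - edgeSurvive Gr W y)
        with hF
      have hsub : IsKilledSubharmonicOn Gr F (U i) := by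
        intro y hy
        have h1 : chainM U L n (j + 1) y = 4⁻¹ * ∑ e : SRW.Dir 2, chainM U L n (j + 1) (y + SRW.stepVec e) := by
          rw [hM]; exact eq_avg_of_isLatticeHarmonicOn (harmExt_harmonicOn (hU i) gM) hy
        have h2 : chainNE Gr U L n (j + 1) y = killedAvg Gr (chainNE Gr U L n (j + 1)) y := by
          rw [hN]; exact killedHarmExt_harmonicOn (hU i) gN y hy
        have h3 : edgeSurvive Gr W y = killedAvg Gr (edgeSurvive Gr W) y :=
          killedHarmExt_harmonicOn hW _ y (hUW i hy)
        -- unfold the killed averages as sums over the four directions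
        simp only [hF, killedAvg] at h2 h3 ⊢
        rw [h1, h2, h3]
        rw [Finset.mul_sum, Finset.mul_sum, Finset.mul_sum, Finset.mul_sum]
        have h4 : (1 : ℝ) = ∑ e : SRW.Dir 2, (4⁻¹ : ℝ) := by
          simp [Finset.card_univ]
        conv_lhs => rw [show (1 : ℝ) - ∑ e : SRW.Dir 2, 4⁻¹ * (if Gr.Adj y (y + SRW.stepVec e) then edgeSurvive Gr W (y + SRW.stepVec e) else 0) =
          ∑ e : SRW.Dir 2, (4⁻¹ - 4⁻¹ * (if Gr.Adj y (y + SRW.stepVec e) then edgeSurvive Gr W (y + SRW.stepVec e) else 0)) by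
          rw [Finset.sum_sub_distrib, ← h4]]
        rw [← Finset.sum_sub_distrib, ← Finset.sum_sub_distrib]
        refine Finset.sum_le_sum fun e _ => ?_
        by_cases ha : Gr.Adj y (y + SRW.stepVec e)
        · simp only [ha, if_true]; linarith
        · simp only [ha, if_false, mul_zero, sub_zero]
          linarith [hM1 (y + SRW.stepVec e)]
      have key := hsub.le_of_forall_boundary_le (hU i) (M := 0) le_rfl (fun w hw => by
        simp only [hF]; linarith [hoff w hw.1]) x hx
      simp only [hF] at key
      linarith
    · exact hoff x hx

end EdgeChain

/-! ### A positive killed-harmonic extension is witnessed by a walk along kept edges -/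

/-- **Witness walk.** If `killedHarmExt Gr S g x > 0` at `x ∈ S` (finite `S`), then
some exit point `w ∉ S` with `g w > 0` is reached from `x` by a walk along `Gr`-edges whose
vertices other than `w` lie in `S`. [folklore] -/
theorem exists_walk_of_killedHarmExt_pos {Gr : SimpleGraph (Site 2)} {S : Set (Site 2)} (hS : S.Finite)
    {g : Site 2 → ℝ} {x : Site 2} (hx : x ∈ S)
    (hpos : 0 < killedHarmExt Gr S g x) :
    ∃ w, w ∉ S ∧ 0 < g w ∧ ∃ p : Gr.Walk x w, ∀ z ∈ p.support, z ∈ S ∨ z = w := by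
  classical
  -- sites reachable from `x` along kept edges inside `S`
  set R : Set (Site 2) := {z | ∃ p : Gr.Walk x z, ∀ y ∈ p.support, y ∈ S} with hR
  have hxR : x ∈ R := ⟨Walk.nil, fun y hy => by rw [Walk.support_nil, List.mem_singleton] at hy; rw [hy]; exact hx⟩
  have hRS : R ⊆ S := fun z ⟨p, hp⟩ => hp z p.end_mem_support
  have hRfin : R.Finite := hS.subset hRS
  set h := killedHarmExt Gr S g with hh
  have hharm : IsKilledHarmonicOn Gr h R := (killedHarmExt_harmonicOn hS g).mono hRS
  -- some exit point of `R` carries a positive value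
  by_contra hcon
  push Not at hcon
  have hbd : ∀ w ∈ killedOuterBoundary Gr R, h w ≤ 0 := by
    intro w hw
    obtain ⟨hwR, z, hz, e, rfl, hadj⟩ := hw
    obtain ⟨p, hp⟩ := hz
    -- `w ∉ S`: otherwise it would be reachable
    have hwS : z + SRW.stepVec e ∉ S := fun hwS =>
      hwR ⟨p.append (Walk.cons hadj Walk.nil), fun y hy => by
        rw [Walk.support_append, List.mem_append] at hy
        rcases hy with hy | hy
        · exact hp y hy
        · simp only [Walk.support_cons, Walk.support_nil, List.tail_cons, List.mem_singleton] at hy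
          rw [hy]; exact hwS⟩
    rw [hh, killedHarmExt_of_not_mem _ hwS]
    -- `g w ≤ 0` by the contradiction hypothesis applied to the walk `x → z → w`
    by_contra hgw
    push Not at hgw
    obtain ⟨y, hy, hyS, hyw⟩ := hcon _ hwS hgw (p.append (Walk.cons hadj Walk.nil))
    rw [Walk.support_append, List.mem_append] at hy
    rcases hy with hy | hy
    · exact hyS (hp y hy)
    · simp only [Walk.support_cons, Walk.support_nil, List.tail_cons, List.mem_singleton] at hy
      exact hyw hy
  have := hharm.le_of_forall_boundary_le hRfin (M := 0) le_rfl hbd x hxR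
  exact absurd hpos (not_lt.2 this)

/-! ### A positive edge-killed chain forces four kept strip crossings -/

section Crossings

variable {Gr : SimpleGraph (Site 2)} {c : Site 2} {k : ℕ}

/-- One step of the edge-killed maneuver along kept edges. [folklore] -/
theorem iter_stepE {i : ℕ} (hi : i < 12) {y : Site 2} (hy : y ∈ mU c k i)
    (hpos : 0 < chainNE Gr (mU c k) (mL c k) 12 (12 - i) y) :
    ∃ y', y' ∈ mL c k i ∧ 0 < chainNE Gr (mU c k) (mL c k) 12 (11 - i) y' ∧
      ∃ p : Gr.Walk y y', ∀ z ∈ p.support, z ∈ mU c k i ∨ z = y' := by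
  classical
  have e1 : 12 - 1 - (11 - i) = i := by omega
  have e2 : 12 - i = (11 - i) + 1 := by omega
  rw [e2] at hpos
  simp only [chainNE, e1] at hpos
  obtain ⟨w, hwU, hwpos, p, hp⟩ := exists_walk_of_killedHarmExt_pos (mU_finite c k i) hy hpos
  split_ifs at hwpos with hw
  · exact ⟨w, hw, hwpos, p, hp⟩
  · exact absurd hwpos (lt_irrefl 0)

/-- **Four kept strip crossings.** If the edge-killed chain is positive at a point of the start
box, then there are walks along `Gr`-edges across the four frame strips: one with vertices in the
band `c₁ + 12k ≤ x₁ ≤ c₁ + 36k` reaching `x₀ ≤ c₀ - 36k` and `x₀ ≥ c₀ + 36k`, and similarly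
for the right, bottom and left strips. [folklore] -/
theorem exists_keptCrossings_of_chainNE_pos (hk : 0 < k) {x : Site 2} (hx : x ∈ mB c k)
    (hpos : 0 < chainNE Gr (mU c k) (mL c k) 12 12 x) :
    (∃ (u v : Site 2) (σ : Gr.Walk u v), (∃ z ∈ σ.support, z 0 ≤ c 0 - 36 * k) ∧ (∃ z ∈ σ.support, c 0 + 36 * k ≤ z 0) ∧
      ∀ z ∈ σ.support, c 1 + 12 * k ≤ z 1 ∧ z 1 ≤ c 1 + 36 * k) ∧
    (∃ (u v : Site 2) (σ : Gr.Walk u v), (∃ z ∈ σ.support, z 1 ≤ c 1 - 36 * k) ∧ (∃ z ∈ σ.support, c 1 + 36 * k ≤ z 1) ∧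
      ∀ z ∈ σ.support, c 0 + 12 * k ≤ z 0 ∧ z 0 ≤ c 0 + 36 * k) ∧
    (∃ (u v : Site 2) (σ : Gr.Walk u v), (∃ z ∈ σ.support, z 0 ≤ c 0 - 36 * k) ∧ (∃ z ∈ σ.support, c 0 + 36 * k ≤ z 0) ∧
      ∀ z ∈ σ.support, c 1 - 36 * k ≤ z 1 ∧ z 1 ≤ c 1 - 12 * k) ∧
    (∃ (u v : Site 2) (σ : Gr.Walk u v), (∃ z ∈ σ.support, z 1 ≤ c 1 - 36 * k) ∧ (∃ z ∈ σ.support, c 1 + 36 * k ≤ z 1) ∧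
      ∀ z ∈ σ.support, c 0 - 36 * k ≤ z 0 ∧ z 0 ≤ c 0 - 12 * k) := by
  have hTU : ∀ {i : ℕ} (hi : i + 1 < 12) {y : Site 2}, y ∈ mL c k i → y ∈ mU c k (i + 1) :=
    fun {i} hi {y} hy => mT_subset_mU hi (mL_subset_mT hk (by omega) hy)
  have hx0 : x ∈ mU c k 0 := mT_subset_mU (by decide) (mB_subset_mT_zero hk hx)
  obtain ⟨y1, hL1, hp1, -⟩ := iter_stepE (Gr := Gr) (by decide : 0 < 12) hx0 hpos
  obtain ⟨y2, hL2, hp2, -⟩ := iter_stepE (by decide : 1 < 12) (hTU (by decide) hL1) hp1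
  obtain ⟨y3, hL3, hp3, p2, hw2⟩ := iter_stepE (by decide : 2 < 12) (hTU (by decide) hL2) hp2
  obtain ⟨y4, hL4, hp4, -⟩ := iter_stepE (by decide : 3 < 12) (hTU (by decide) hL3) hp3
  obtain ⟨y5, hL5, hp5, -⟩ := iter_stepE (by decide : 4 < 12) (hTU (by decide) hL4) hp4
  obtain ⟨y6, hL6, hp6, p5, hw5⟩ := iter_stepE (by decide : 5 < 12) (hTU (by decide) hL5) hp5
  obtain ⟨y7, hL7, hp7, -⟩ := iter_stepE (by decide : 6 < 12) (hTU (by decide) hL6) hp6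
  obtain ⟨y8, hL8, hp8, -⟩ := iter_stepE (by decide : 7 < 12) (hTU (by decide) hL7) hp7
  obtain ⟨y9, hL9, hp9, p8, hw8⟩ := iter_stepE (by decide : 8 < 12) (hTU (by decide) hL8) hp8
  obtain ⟨y10, hL10, hp10, -⟩ := iter_stepE (by decide : 9 < 12) (hTU (by decide) hL9) hp9
  obtain ⟨y11, hL11, hp11, -⟩ := iter_stepE (by decide : 10 < 12) (hTU (by decide) hL10) hp10
  obtain ⟨y12, hL12, -, p11, hw11⟩ := iter_stepE (by decide : 11 < 12) (hTU (by decide) hL11) hp11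
  simp only [mL, mU, maneuver, MStep.L, MStep.U, MStep.corner, rectInterior, Set.mem_setOf_eq,
    Matrix.cons_val_zero, Matrix.cons_val_one, show (1:ℕ) < 12 by decide, show (2:ℕ) < 12 by decide,
    show (4:ℕ) < 12 by decide, show (5:ℕ) < 12 by decide, show (7:ℕ) < 12 by decide, show (8:ℕ) < 12 by decide,
    show (10:ℕ) < 12 by decide, show (11:ℕ) < 12 by decide, dif_pos] at hL2 hL3 hL5 hL6 hL8 hL9 hL11 hL12 hw2 hw5 hw8 hw11
  simp at hL2 hL3 hL5 hL6 hL8 hL9 hL11 hL12 hw2 hw5 hw8 hw11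
  refine ⟨⟨y2, y3, p2, ⟨y2, p2.start_mem_support, by omega⟩, ⟨y3, p2.end_mem_support, by omega⟩, fun z hz => ?_⟩,
    ⟨y5, y6, p5, ⟨y6, p5.end_mem_support, by omega⟩, ⟨y5, p5.start_mem_support, by omega⟩, fun z hz => ?_⟩,
    ⟨y8, y9, p8, ⟨y9, p8.end_mem_support, by omega⟩, ⟨y8, p8.start_mem_support, by omega⟩, fun z hz => ?_⟩,
    ⟨y11, y12, p11, ⟨y11, p11.start_mem_support, by omega⟩, ⟨y12, p11.end_mem_support, by omega⟩, fun z hz => ?_⟩⟩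
  · have h1 := hw2 z hz; rcases h1 with h | rfl <;> omega
  · have h1 := hw5 z hz; rcases h1 with h | rfl <;> omega
  · have h1 := hw8 z hz; rcases h1 with h | rfl <;> omega
  · have h1 := hw11 z hz; rcases h1 with h | rfl <;> omega

end Crossings

/-! ### Planar traces of lattice walks -/

section Trace

variable {G : SimpleGraph (Site 2)}

/-- **The planar trace of a lattice walk**: the union of the closed segments of its edges (the
start point for the trivial walk). [folklore] -/
def walkTrace : {u v : Site 2} → G.Walk u v → Set ℂ
  | u, _, Walk.nil => {Site.toComplex u}
  | u, _, Walk.cons (v := w) _ p => segment ℝ (Site.toComplex u) (Site.toComplex w) ∪ walkTrace p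

/-- Unfolding for `cons`. [folklore] -/
theorem walkTrace_cons {u w v : Site 2} (h : G.Adj u w) (p : G.Walk w v) :
    walkTrace (Walk.cons h p) = segment ℝ (Site.toComplex u) (Site.toComplex w) ∪ walkTrace p := rfl

/-- Unfolding for `nil`. [folklore] -/
theorem walkTrace_nil {u : Site 2} : walkTrace (Walk.nil : G.Walk u u) = {Site.toComplex u} := rfl

/-- The start point lies on the trace. [folklore] -/
theorem toComplex_start_mem_walkTrace {u v : Site 2} (p : G.Walk u v) : Site.toComplex u ∈ walkTrace p := by
  cases p with
  | nil => exact rfl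
  | cons h p => exact Or.inl (left_mem_segment _ _ _)

/-- Every vertex of the walk lies on the trace. [folklore] -/
theorem toComplex_mem_walkTrace {u v : Site 2} (p : G.Walk u v) {z : Site 2} (hz : z ∈ p.support) :
    Site.toComplex z ∈ walkTrace p := by
  induction p with
  | nil => rw [Walk.support_nil, List.mem_singleton] at hz; rw [hz]; exact rfl
  | cons h p ih =>
    rw [Walk.support_cons, List.mem_cons] at hz
    rcases hz with rfl | hz
    · exact Or.inl (left_mem_segment _ _ _)
    · exact Or.inr (ih hz)

/-- The trace is compact. [folklore] -/
theorem isCompact_walkTrace {u v : Site 2} (p : G.Walk u v) : IsCompact (walkTrace p) := by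
  induction p with
  | nil => exact isCompact_singleton
  | cons h p ih =>
    refine IsCompact.union ?_ ih
    rw [segment_eq_image_lineMap]; exact isCompact_Icc.image AffineMap.lineMap_continuous

/-- The trace is preconnected. [folklore] -/
theorem isPreconnected_walkTrace {u v : Site 2} (p : G.Walk u v) : IsPreconnected (walkTrace p) := by
  induction p with
  | nil => exact isPreconnected_singleton
  | cons h p ih =>
    rename_i u' w' v'
    exact IsPreconnected.union (Site.toComplex w') (right_mem_segment _ _ _) (toComplex_start_mem_walkTrace p)
      (convex_segment _ _).isPreconnected ih

/-- A point of the trace is the start point or lies on the segment of an edge of `G`. [folklore] -/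
theorem mem_walkTrace_cases {u v : Site 2} (p : G.Walk u v) {q : ℂ} (hq : q ∈ walkTrace p) :
    q = Site.toComplex u ∨ ∃ a b : Site 2, G.Adj a b ∧ q ∈ segment ℝ (Site.toComplex a) (Site.toComplex b) := by
  induction p with
  | nil => exact Or.inl hq
  | cons h p ih =>
    rcases hq with hq | hq
    · exact Or.inr ⟨_, _, h, hq⟩
    · rcases ih hq with rfl | h'
      · exact Or.inr ⟨_, _, h, right_mem_segment _ _ _⟩
      · exact Or.inr h'

/-- For a walk of positive length, every point of the trace lies on the segment of an edge. [folklore] -/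
theorem exists_adj_mem_segment_of_mem_walkTrace {u v : Site 2} (p : G.Walk u v) (hp : 0 < p.length) {q : ℂ}
    (hq : q ∈ walkTrace p) : ∃ a b : Site 2, G.Adj a b ∧ q ∈ segment ℝ (Site.toComplex a) (Site.toComplex b) := by
  cases p with
  | nil => simp at hp
  | cons h p =>
    rcases hq with hq | hq
    · exact ⟨_, _, h, hq⟩
    · rcases mem_walkTrace_cases p hq with rfl | h'
      · exact ⟨_, _, h, right_mem_segment _ _ _⟩
      · exact h'

/-- **Band bounds pass to the trace** (second coordinate). [folklore] -/
theorem im_mem_Icc_of_mem_walkTrace {u v : Site 2} (p : G.Walk u v) {lo hi : ℝ}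
    (hsupp : ∀ z ∈ p.support, lo ≤ (z 1 : ℝ) ∧ (z 1 : ℝ) ≤ hi) {q : ℂ} (hq : q ∈ walkTrace p) :
    lo ≤ q.im ∧ q.im ≤ hi := by
  induction p with
  | nil =>
    rename_i u'
    rw [walkTrace_nil, mem_singleton_iff] at hq
    rw [hq, Site.toComplex_im]; exact hsupp u' (by simp)
  | cons h p ih =>
    rename_i u' w' v'
    rcases hq with hq | hq
    · obtain ⟨a, b, ha, hb, hab, rfl⟩ := hq
      have hu := hsupp u' (by simp)
      have hw := hsupp w' (by simp)
      simp only [Complex.add_im, Complex.smul_im, smul_eq_mul, Site.toComplex_im]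
      have e1 : a * lo + b * lo = lo := by rw [← add_mul, hab, one_mul]
      have e2 : a * hi + b * hi = hi := by rw [← add_mul, hab, one_mul]
      constructor <;> nlinarith [mul_nonneg ha (sub_nonneg.2 hu.1), mul_nonneg hb (sub_nonneg.2 hw.1),
        mul_nonneg ha (sub_nonneg.2 hu.2), mul_nonneg hb (sub_nonneg.2 hw.2)]
    · exact ih (fun z hz => hsupp z (by simp [hz])) hq

/-- **Band bounds pass to the trace** (first coordinate). [folklore] -/
theorem re_mem_Icc_of_mem_walkTrace {u v : Site 2} (p : G.Walk u v) {lo hi : ℝ}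
    (hsupp : ∀ z ∈ p.support, lo ≤ (z 0 : ℝ) ∧ (z 0 : ℝ) ≤ hi) {q : ℂ} (hq : q ∈ walkTrace p) :
    lo ≤ q.re ∧ q.re ≤ hi := by
  induction p with
  | nil =>
    rename_i u'
    rw [walkTrace_nil, mem_singleton_iff] at hq
    rw [hq, Site.toComplex_re]; exact hsupp u' (by simp)
  | cons h p ih =>
    rename_i u' w' v'
    rcases hq with hq | hq
    · obtain ⟨a, b, ha, hb, hab, rfl⟩ := hq
      have hu := hsupp u' (by simp)
      have hw := hsupp w' (by simp)
      simp only [Complex.add_re, Complex.smul_re, smul_eq_mul, Site.toComplex_re]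
      have e1 : a * lo + b * lo = lo := by rw [← add_mul, hab, one_mul]
      have e2 : a * hi + b * hi = hi := by rw [← add_mul, hab, one_mul]
      constructor <;> nlinarith [mul_nonneg ha (sub_nonneg.2 hu.1), mul_nonneg hb (sub_nonneg.2 hw.1),
        mul_nonneg ha (sub_nonneg.2 hu.2), mul_nonneg hb (sub_nonneg.2 hw.2)]
    · exact ih (fun z hz => hsupp z (by simp [hz])) hq

end Trace

/-! ### Kept crossings around a boundary point are impossible -/

section Jordan

open Metric Complex
open Literature.Probability.RandomPlanarGeometry (JordanDomain)
open Literature.Topology.PlaneTopology (IsJordanLoop inter_nonempty_of_plus exists_subpath_crossing_levels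
  joinedIn_of_isPreconnected)

variable (D : JordanDomain) {δ : ℝ}

/-- A point of the segment of a kept edge, scaled by the mesh, lies in `closure D`. [folklore] -/
theorem _root_.Literature.Probability.RandomPlanarGeometry.JordanDomain.mul_mem_closure_of_mem_segment
    {a b : Site 2} (hadj : (discreteDomainGraph D.carrier δ).Adj a b) {q : ℂ}
    (hq : q ∈ segment ℝ (Site.toComplex a) (Site.toComplex b)) : (δ : ℂ) * q ∈ closure D.carrier := by
  have hseg := (meshGraph_adj_iff.1 (discreteDomainGraph_adj_iff.1 hadj).1).2
  obtain ⟨α, β, hα, hβ, hαβ, rfl⟩ := hq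
  refine hseg ⟨α, β, hα, hβ, hαβ, ?_⟩
  simp only [meshPoint, Complex.real_smul]; ring

/-- A walk with vertices of first coordinate `≤ A` and `≥ B > A` has positive length. [folklore] -/
theorem length_pos_of_far_points {G : SimpleGraph (Site 2)} {u v : Site 2} (σ : G.Walk u v) (i : Fin 2) {A B : ℤ}
    (hAB : A < B) (h1 : ∃ z ∈ σ.support, z i ≤ A) (h2 : ∃ z ∈ σ.support, B ≤ z i) : 0 < σ.length := by
  cases σ with
  | nil =>
    obtain ⟨z, hz, hzA⟩ := h1; obtain ⟨z', hz', hzB⟩ := h2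
    rw [Walk.support_nil, List.mem_singleton] at hz hz'
    subst hz; subst hz'; omega
  | cons h p => simp

/-- **Kept crossings of the four frame strips around a boundary point are impossible.** If a
boundary point `p ∈ ∂D` lies (read on the mesh `δℤ²`) in the open box of radius `12k` about `c`,
there cannot be walks along edges of `Ω^δ = discreteDomainGraph D δ` across the four strips of the
frame `[c ± 36k]² ∖ (c ± 12k)²` as in `exists_keptCrossings_of_chainNE_pos`: an exterior point next
to `p` is joined to a far exterior point by a path in the (open, connected, unbounded) outside of
`∂D`; this path crosses one of the strips transversally, hence meets the corresponding kept trace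
(`inter_nonempty_of_plus`) — at a point of `closure D ∩ (closure D)ᶜ`. [folklore] -/
theorem _root_.Literature.Probability.RandomPlanarGeometry.JordanDomain.false_of_keptCrossings (hδ : 0 < δ)
    {c : Site 2} {k : ℕ} (hk : 0 < k) {p : ℂ} (hp : p ∈ frontier D.carrier)
    (hp0 : |p.re / δ - c 0| < 12 * k) (hp1 : |p.im / δ - c 1| < 12 * k)
    (hT : ∃ (u v : Site 2) (σ : (discreteDomainGraph D.carrier δ).Walk u v),
      (∃ z ∈ σ.support, z 0 ≤ c 0 - 36 * k) ∧ (∃ z ∈ σ.support, c 0 + 36 * k ≤ z 0) ∧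
      ∀ z ∈ σ.support, c 1 + 12 * k ≤ z 1 ∧ z 1 ≤ c 1 + 36 * k)
    (hR : ∃ (u v : Site 2) (σ : (discreteDomainGraph D.carrier δ).Walk u v),
      (∃ z ∈ σ.support, z 1 ≤ c 1 - 36 * k) ∧ (∃ z ∈ σ.support, c 1 + 36 * k ≤ z 1) ∧
      ∀ z ∈ σ.support, c 0 + 12 * k ≤ z 0 ∧ z 0 ≤ c 0 + 36 * k)
    (hB : ∃ (u v : Site 2) (σ : (discreteDomainGraph D.carrier δ).Walk u v),
      (∃ z ∈ σ.support, z 0 ≤ c 0 - 36 * k) ∧ (∃ z ∈ σ.support, c 0 + 36 * k ≤ z 0) ∧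
      ∀ z ∈ σ.support, c 1 - 36 * k ≤ z 1 ∧ z 1 ≤ c 1 - 12 * k)
    (hLft : ∃ (u v : Site 2) (σ : (discreteDomainGraph D.carrier δ).Walk u v),
      (∃ z ∈ σ.support, z 1 ≤ c 1 - 36 * k) ∧ (∃ z ∈ σ.support, c 1 + 36 * k ≤ z 1) ∧
      ∀ z ∈ σ.support, c 0 - 36 * k ≤ z 0 ∧ z 0 ≤ c 0 - 12 * k) : False := by
  have hJ : IsJordanLoop D.boundary := D.isJordanLoop_boundary
  set O := IsJordanLoop.outside D.boundary with hO
  have hOc : O = (closure D.carrier)ᶜ := D.outside_boundary_eq_compl_closure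
  have hk' : (0 : ℝ) < k := by exact_mod_cast hk
  -- ### an exterior point next to `p`, inside the start box
  obtain ⟨e₀, he₀O, he₀⟩ : ∃ e₀ ∈ O, |e₀.re / δ - c 0| < 12 * k ∧ |e₀.im / δ - c 1| < 12 * k := by
    set η : ℝ := 12 * k - max |p.re / δ - c 0| |p.im / δ - c 1| with hη
    have hηpos : 0 < η := by rw [hη]; exact sub_pos.2 (max_lt hp0 hp1)
    have hpcl : p ∈ closure O := hJ.range_subset_closure_outside (by rw [D.range_boundary]; exact hp)
    obtain ⟨e₀, he₀, hd⟩ := Metric.mem_closure_iff.1 hpcl (δ * η) (by positivity)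
    have hd' : ‖e₀ - p‖ < δ * η := by rwa [_root_.dist_comm, dist_eq_norm] at hd
    refine ⟨e₀, he₀, ?_, ?_⟩
    · have h1 : |e₀.re - p.re| < δ * η := (abs_re_le_norm (e₀ - p)).trans_lt hd'
      have h2 : |e₀.re / δ - p.re / δ| < η := by
        rw [← sub_div, abs_div, abs_of_pos hδ, div_lt_iff₀ hδ]; linarith
      calc |e₀.re / δ - c 0| ≤ |e₀.re / δ - p.re / δ| + |p.re / δ - c 0| := abs_sub_le _ _ _
        _ < η + max |p.re / δ - c 0| |p.im / δ - c 1| := add_lt_add_of_lt_of_le h2 (le_max_left _ _)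
        _ = 12 * k := by rw [hη]; ring
    · have h1 : |e₀.im - p.im| < δ * η := (abs_im_le_norm (e₀ - p)).trans_lt hd'
      have h2 : |e₀.im / δ - p.im / δ| < η := by
        rw [← sub_div, abs_div, abs_of_pos hδ, div_lt_iff₀ hδ]; linarith
      calc |e₀.im / δ - c 1| ≤ |e₀.im / δ - p.im / δ| + |p.im / δ - c 1| := abs_sub_le _ _ _
        _ < η + max |p.re / δ - c 0| |p.im / δ - c 1| := add_lt_add_of_lt_of_le h2 (le_max_right _ _)
        _ = 12 * k := by rw [hη]; ring
  -- ### a far exterior point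
  obtain ⟨e₁, he₁O, he₁⟩ : ∃ e₁ ∈ O, 36 * k < |e₁.re / δ - c 0| ∨ 36 * k < |e₁.im / δ - c 1| := by
    have hnb := hJ.not_isBounded_outside
    rw [isBounded_iff_subset_closedBall 0] at hnb
    push Not at hnb
    obtain ⟨e₁, he₁, hfar⟩ := Set.not_subset.1 (hnb (δ * (2 * |(c 0 : ℝ)| + 2 * |(c 1 : ℝ)| + 100 * k)))
    rw [mem_closedBall, dist_zero_right, not_le] at hfar
    refine ⟨e₁, he₁, ?_⟩
    have hsum : ‖e₁‖ ≤ |e₁.re| + |e₁.im| := norm_le_abs_re_add_abs_im e₁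
    by_cases hre : δ * (|(c 0 : ℝ)| + 36 * k) < |e₁.re|
    · left
      have : |(c 0 : ℝ)| + 36 * k < |e₁.re / δ| := by rw [abs_div, abs_of_pos hδ, lt_div_iff₀ hδ]; linarith
      have h3 : |e₁.re / δ| ≤ |e₁.re / δ - c 0| + |(c 0 : ℝ)| := by
        have := abs_add_le (e₁.re / δ - c 0) (c 0); rwa [sub_add_cancel] at this
      linarith
    · right
      push Not at hre
      have him : δ * (|(c 1 : ℝ)| + 36 * k) < |e₁.im| := by nlinarith [abs_nonneg (c 0 : ℝ), abs_nonneg (c 1 : ℝ)]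
      have : |(c 1 : ℝ)| + 36 * k < |e₁.im / δ| := by rw [abs_div, abs_of_pos hδ, lt_div_iff₀ hδ]; linarith
      have h3 : |e₁.im / δ| ≤ |e₁.im / δ - c 1| + |(c 1 : ℝ)| := by
        have := abs_add_le (e₁.im / δ - c 1) (c 1); rwa [sub_add_cancel] at this
      linarith
  -- ### a path in the outside, read in lattice coordinates
  obtain ⟨γ, hγ⟩ : JoinedIn O e₀ e₁ :=
    joinedIn_of_isPreconnected hJ.isOpen_outside hJ.isPreconnected_outside subset_rfl he₀O he₁O
  set g : ℝ → ℂ := fun t => ((δ⁻¹ : ℝ) : ℂ) * γ.extend t with hg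
  have hgc : Continuous g := continuous_const.mul γ.continuous_extend
  have hgO : ∀ t, (δ : ℂ) * g t ∈ O := by
    intro t
    have : (δ : ℂ) * g t = γ.extend t := by
      simp only [hg]; rw [← mul_assoc, ← Complex.ofReal_mul, mul_inv_cancel₀ hδ.ne', Complex.ofReal_one, one_mul]
    rw [this]
    obtain ⟨s, hs⟩ : γ.extend t ∈ range γ := by rw [← γ.extend_range]; exact mem_range_self t
    rw [← hs]; exact hγ s
  have hgre : ∀ t, (g t).re = (γ.extend t).re / δ := fun t => by
    simp only [hg, Complex.re_ofReal_mul]; rw [div_eq_inv_mul]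
  have hgim : ∀ t, (g t).im = (γ.extend t).im / δ := fun t => by
    simp only [hg, Complex.im_ofReal_mul]; rw [div_eq_inv_mul]
  have hg0re : |(g 0).re - c 0| < 12 * k := by rw [hgre, γ.extend_zero]; exact he₀.1
  have hg0im : |(g 0).im - c 1| < 12 * k := by rw [hgim, γ.extend_zero]; exact he₀.2
  have hg1 : 36 * k < |(g 1).re - c 0| ∨ 36 * k < |(g 1).im - c 1| := by rw [hgre, hgim, γ.extend_one]; exact he₁
  -- ### kept traces never meet the exterior path
  have key : ∀ {u v : Site 2} (σ : (discreteDomainGraph D.carrier δ).Walk u v), 0 < σ.length →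
      ∀ t, g t ∉ walkTrace σ := by
    intro u v σ hσ t ht
    obtain ⟨a, b, hab, hq⟩ := exists_adj_mem_segment_of_mem_walkTrace σ hσ ht
    have h1 := D.mul_mem_closure_of_mem_segment hab hq
    have h2 := hgO t
    rw [hOc] at h2
    exact h2 h1
  -- ### the first exit of the exterior path from the big box
  set f : ℝ → ℝ := fun t => max |(g t).re - c 0| |(g t).im - c 1| with hf
  have hfc : Continuous f := by
    simp only [hf]
    fun_prop
  set T : Set ℝ := {t | t ∈ Icc (0 : ℝ) 1 ∧ 36 * k ≤ f t} with hTdef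
  have hT1 : (1 : ℝ) ∈ T := ⟨⟨zero_le_one, le_rfl⟩, by
    rcases hg1 with h | h
    · exact h.le.trans (le_max_left _ _)
    · exact h.le.trans (le_max_right _ _)⟩
  have hTne : T.Nonempty := ⟨1, hT1⟩
  have hTbdd : BddBelow T := ⟨0, fun t ht => ht.1.1⟩
  have hTcl : IsClosed T := by
    rw [hTdef, show {t | t ∈ Icc (0 : ℝ) 1 ∧ 36 * k ≤ f t} = Icc 0 1 ∩ {t | 36 * k ≤ f t} from rfl]
    exact isClosed_Icc.inter (isClosed_le continuous_const hfc)
  set τ := sInf T with hτ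
  have hτT : τ ∈ T := hTcl.csInf_mem hTne hTbdd
  have hτ01 : τ ∈ Icc (0 : ℝ) 1 := hτT.1
  have hf0 : f 0 < 36 * k := max_lt (by linarith) (by linarith)
  have hτpos : 0 < τ := by
    rcases eq_or_lt_of_le hτ01.1 with h | h
    · exfalso; have := hτT.2; rw [← h] at this; linarith
    · exact h
  have hbelow : ∀ t, 0 ≤ t → t < τ → f t < 36 * k := by
    intro t ht0 htτ
    by_contra hcon
    push Not at hcon
    have : τ ≤ t := csInf_le hTbdd ⟨⟨ht0, htτ.le.trans hτ01.2⟩, hcon⟩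
    linarith
  have hτle : f τ ≤ 36 * k := by
    -- closedness of `{f ≤ 36k}` and density of `[0, τ)` at `τ`
    have hmem : τ ∈ closure (Set.Ico 0 τ) := by rw [closure_Ico hτpos.ne]; exact right_mem_Icc.2 hτpos.le
    have hsub : Set.Ico 0 τ ⊆ {s | f s ≤ 36 * k} := fun s hs => (hbelow s hs.1 hs.2).le
    exact (isClosed_le hfc continuous_const).closure_subset_iff.2 hsub hmem
  have hbox : ∀ t, 0 ≤ t → t ≤ τ → f t ≤ 36 * k := by
    intro t ht0 htτ
    rcases eq_or_lt_of_le htτ with h | hlt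
    · rw [h]; exact hτle
    · exact (hbelow t ht0 hlt).le
  have hboxre : ∀ t, 0 ≤ t → t ≤ τ → (c 0 : ℝ) - 36 * k ≤ (g t).re ∧ (g t).re ≤ c 0 + 36 * k := by
    intro t ht0 htτ
    have := (le_max_left _ _).trans (hbox t ht0 htτ)
    rw [abs_le] at this; constructor <;> linarith [this.1, this.2]
  have hboxim : ∀ t, 0 ≤ t → t ≤ τ → (c 1 : ℝ) - 36 * k ≤ (g t).im ∧ (g t).im ≤ c 1 + 36 * k := by
    intro t ht0 htτ
    have := (le_max_right _ _).trans (hbox t ht0 htτ)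
    rw [abs_le] at this; constructor <;> linarith [this.1, this.2]
  have hfτ : f τ = 36 * k := le_antisymm hτle hτT.2
  -- the exit side
  have hside : (g τ).im = c 1 + 36 * k ∨ (g τ).im = c 1 - 36 * k ∨ (g τ).re = c 0 + 36 * k ∨ (g τ).re = c 0 - 36 * k := by
    simp only [hf] at hfτ
    rcases le_total |(g τ).re - c 0| |(g τ).im - c 1| with h | h
    · rw [max_eq_right h] at hfτ
      rcases abs_eq (by positivity : (0 : ℝ) ≤ 36 * k) |>.1 hfτ with h' | h'
      · left; linarith
      · right; left; linarith
    · rw [max_eq_left h] at hfτ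
      rcases abs_eq (by positivity : (0 : ℝ) ≤ 36 * k) |>.1 hfτ with h' | h'
      · right; right; left; linarith
      · right; right; right; linarith
  -- the two reparametrisations of `g|[0, τ]`
  set gb : ℝ → ℂ := fun s => g (τ * (1 - s)) with hgb   -- backwards: `gb 0 = g τ`, `gb 1 = g 0`
  set gf : ℝ → ℂ := fun s => g (τ * s) with hgf         -- forwards
  have hgbc : Continuous gb := hgc.comp (by fun_prop)
  have hgfc : Continuous gf := hgc.comp (by fun_prop)
  have hpar_b : ∀ s, 0 ≤ s → s ≤ 1 → 0 ≤ τ * (1 - s) ∧ τ * (1 - s) ≤ τ := fun s h0 h1 =>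
    ⟨by nlinarith, by nlinarith⟩
  have hpar_f : ∀ s, 0 ≤ s → s ≤ 1 → 0 ≤ τ * s ∧ τ * s ≤ τ := fun s h0 h1 => ⟨by nlinarith, by nlinarith⟩
  -- casts of the lattice data
  have castT : ∀ {u v : Site 2} (σ : (discreteDomainGraph D.carrier δ).Walk u v) {lo hi : ℤ} (i : Fin 2),
      (∀ z ∈ σ.support, lo ≤ z i ∧ z i ≤ hi) → ∀ z ∈ σ.support, ((lo : ℤ) : ℝ) ≤ (z i : ℝ) ∧ (z i : ℝ) ≤ ((hi : ℤ) : ℝ) := by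
    intro u v σ lo hi i h z hz
    exact ⟨by exact_mod_cast (h z hz).1, by exact_mod_cast (h z hz).2⟩
  rcases hside with htop | hbot | hright | hleft
  · -- ### top strip: the exterior path crosses it vertically, `hT` horizontally
    obtain ⟨u, v, σ, ⟨zl, hzl, hzl'⟩, ⟨zr, hzr, hzr'⟩, hband⟩ := hT
    have hlen := length_pos_of_far_points σ 0 (by omega : c 0 - 36 * k < c 0 + 36 * k) ⟨zl, hzl, hzl'⟩ ⟨zr, hzr, hzr'⟩
    obtain ⟨s₁, s₂, hs₁, hs₁₂, hs₂, hlev₁, hlev₂, -⟩ := exists_subpath_crossing_levels hgbc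
      (show (c 1 : ℝ) + 12 * k < c 1 + 36 * k by linarith)
      (show (c 1 : ℝ) + 36 * k ≤ (gb 0).im by simp only [hgb, sub_zero, mul_one]; rw [htop])
      (show (gb 1).im ≤ (c 1 : ℝ) + 12 * k by
        simp only [hgb, sub_self, mul_zero]; have := hg0im; rw [abs_lt] at this; linarith [this.2])
    obtain ⟨q, hqV, hqH⟩ := inter_nonempty_of_plus (V := gb '' Icc s₁ s₂) (H := walkTrace σ)
      (show (c 0 : ℝ) - 36 * k ≤ c 0 + 36 * k by linarith) (show (c 1 : ℝ) + 12 * k ≤ c 1 + 36 * k by linarith)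
      (isCompact_Icc.image hgbc) (isPreconnected_Icc.image _ hgbc.continuousOn)
      (by rintro _ ⟨s, hs, rfl⟩; exact hboxre _ (hpar_b s (hs₁.trans hs.1) (hs.2.trans hs₂)).1 (hpar_b s (hs₁.trans hs.1) (hs.2.trans hs₂)).2)
      ⟨gb s₂, ⟨s₂, right_mem_Icc.2 hs₁₂.le, rfl⟩, hlev₂.le⟩ ⟨gb s₁, ⟨s₁, left_mem_Icc.2 hs₁₂.le, rfl⟩, hlev₁.ge⟩
      (isCompact_walkTrace σ) (isPreconnected_walkTrace σ)
      (fun z hz => by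
        have := im_mem_Icc_of_mem_walkTrace σ (castT σ 1 hband) hz
        push_cast at this; exact this)
      ⟨Site.toComplex zl, toComplex_mem_walkTrace σ hzl, by rw [Site.toComplex_re]; exact_mod_cast hzl'⟩
      ⟨Site.toComplex zr, toComplex_mem_walkTrace σ hzr, by rw [Site.toComplex_re]; exact_mod_cast hzr'⟩
    obtain ⟨s, -, rfl⟩ := hqV
    exact key σ hlen _ hqH
  · -- ### bottom strip
    obtain ⟨u, v, σ, ⟨zl, hzl, hzl'⟩, ⟨zr, hzr, hzr'⟩, hband⟩ := hB
    have hlen := length_pos_of_far_points σ 0 (by omega : c 0 - 36 * k < c 0 + 36 * k) ⟨zl, hzl, hzl'⟩ ⟨zr, hzr, hzr'⟩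
    obtain ⟨s₁, s₂, hs₁, hs₁₂, hs₂, hlev₁, hlev₂, -⟩ := exists_subpath_crossing_levels hgfc
      (show (c 1 : ℝ) - 36 * k < c 1 - 12 * k by linarith)
      (show (c 1 : ℝ) - 12 * k ≤ (gf 0).im by
        simp only [hgf, mul_zero]; have := hg0im; rw [abs_lt] at this; linarith [this.1])
      (show (gf 1).im ≤ (c 1 : ℝ) - 36 * k by simp only [hgf, mul_one]; rw [hbot])
    obtain ⟨q, hqV, hqH⟩ := inter_nonempty_of_plus (V := gf '' Icc s₁ s₂) (H := walkTrace σ)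
      (show (c 0 : ℝ) - 36 * k ≤ c 0 + 36 * k by linarith) (show (c 1 : ℝ) - 36 * k ≤ c 1 - 12 * k by linarith)
      (isCompact_Icc.image hgfc) (isPreconnected_Icc.image _ hgfc.continuousOn)
      (by rintro _ ⟨s, hs, rfl⟩; exact hboxre _ (hpar_f s (hs₁.trans hs.1) (hs.2.trans hs₂)).1 (hpar_f s (hs₁.trans hs.1) (hs.2.trans hs₂)).2)
      ⟨gf s₂, ⟨s₂, right_mem_Icc.2 hs₁₂.le, rfl⟩, hlev₂.le⟩ ⟨gf s₁, ⟨s₁, left_mem_Icc.2 hs₁₂.le, rfl⟩, hlev₁.ge⟩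
      (isCompact_walkTrace σ) (isPreconnected_walkTrace σ)
      (fun z hz => by
        have := im_mem_Icc_of_mem_walkTrace σ (castT σ 1 hband) hz
        push_cast at this; exact this)
      ⟨Site.toComplex zl, toComplex_mem_walkTrace σ hzl, by rw [Site.toComplex_re]; exact_mod_cast hzl'⟩
      ⟨Site.toComplex zr, toComplex_mem_walkTrace σ hzr, by rw [Site.toComplex_re]; exact_mod_cast hzr'⟩
    obtain ⟨s, -, rfl⟩ := hqV
    exact key σ hlen _ hqH
  · -- ### right strip: the exterior path crosses it horizontally, `hR` vertically
    obtain ⟨u, v, σ, ⟨zl, hzl, hzl'⟩, ⟨zr, hzr, hzr'⟩, hband⟩ := hR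
    have hlen := length_pos_of_far_points σ 1 (by omega : c 1 - 36 * k < c 1 + 36 * k) ⟨zl, hzl, hzl'⟩ ⟨zr, hzr, hzr'⟩
    -- swap the coordinates to extract a crossing of the levels of `re`
    set gs : ℝ → ℂ := fun s => Complex.I * (starRingEnd ℂ) (gb s) with hgs
    have hgsc : Continuous gs := continuous_const.mul (Complex.continuous_conj.comp hgbc)
    have hgs_im : ∀ s, (gs s).im = (gb s).re := fun s => by simp [hgs]
    obtain ⟨s₁, s₂, hs₁, hs₁₂, hs₂, hlev₁, hlev₂, -⟩ := exists_subpath_crossing_levels hgsc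
      (show (c 0 : ℝ) + 12 * k < c 0 + 36 * k by linarith)
      (show (c 0 : ℝ) + 36 * k ≤ (gs 0).im by rw [hgs_im]; simp only [hgb, sub_zero, mul_one]; rw [hright])
      (show (gs 1).im ≤ (c 0 : ℝ) + 12 * k by
        rw [hgs_im]; simp only [hgb, sub_self, mul_zero]; have := hg0re; rw [abs_lt] at this; linarith [this.2])
    rw [hgs_im] at hlev₁ hlev₂
    obtain ⟨q, hqV, hqH⟩ := inter_nonempty_of_plus (V := walkTrace σ) (H := gb '' Icc s₁ s₂)
      (show (c 0 : ℝ) + 12 * k ≤ c 0 + 36 * k by linarith) (show (c 1 : ℝ) - 36 * k ≤ c 1 + 36 * k by linarith)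
      (isCompact_walkTrace σ) (isPreconnected_walkTrace σ)
      (fun z hz => by
        have := re_mem_Icc_of_mem_walkTrace σ (castT σ 0 hband) hz
        push_cast at this; exact this)
      ⟨Site.toComplex zl, toComplex_mem_walkTrace σ hzl, by rw [Site.toComplex_im]; exact_mod_cast hzl'⟩
      ⟨Site.toComplex zr, toComplex_mem_walkTrace σ hzr, by rw [Site.toComplex_im]; exact_mod_cast hzr'⟩
      (isCompact_Icc.image hgbc) (isPreconnected_Icc.image _ hgbc.continuousOn)
      (by rintro _ ⟨s, hs, rfl⟩; exact hboxim _ (hpar_b s (hs₁.trans hs.1) (hs.2.trans hs₂)).1 (hpar_b s (hs₁.trans hs.1) (hs.2.trans hs₂)).2)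
      ⟨gb s₂, ⟨s₂, right_mem_Icc.2 hs₁₂.le, rfl⟩, hlev₂.le⟩ ⟨gb s₁, ⟨s₁, left_mem_Icc.2 hs₁₂.le, rfl⟩, hlev₁.ge⟩
    obtain ⟨s, -, rfl⟩ := hqH
    exact key σ hlen _ hqV
  · -- ### left strip
    obtain ⟨u, v, σ, ⟨zl, hzl, hzl'⟩, ⟨zr, hzr, hzr'⟩, hband⟩ := hLft
    have hlen := length_pos_of_far_points σ 1 (by omega : c 1 - 36 * k < c 1 + 36 * k) ⟨zl, hzl, hzl'⟩ ⟨zr, hzr, hzr'⟩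
    set gs : ℝ → ℂ := fun s => Complex.I * (starRingEnd ℂ) (gf s) with hgs
    have hgsc : Continuous gs := continuous_const.mul (Complex.continuous_conj.comp hgfc)
    have hgs_im : ∀ s, (gs s).im = (gf s).re := fun s => by simp [hgs]
    obtain ⟨s₁, s₂, hs₁, hs₁₂, hs₂, hlev₁, hlev₂, -⟩ := exists_subpath_crossing_levels hgsc
      (show (c 0 : ℝ) - 36 * k < c 0 - 12 * k by linarith)
      (show (c 0 : ℝ) - 12 * k ≤ (gs 0).im by
        rw [hgs_im]; simp only [hgf, mul_zero]; have := hg0re; rw [abs_lt] at this; linarith [this.1])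
      (show (gs 1).im ≤ (c 0 : ℝ) - 36 * k by rw [hgs_im]; simp only [hgf, mul_one]; rw [hleft])
    rw [hgs_im] at hlev₁ hlev₂
    obtain ⟨q, hqV, hqH⟩ := inter_nonempty_of_plus (V := walkTrace σ) (H := gf '' Icc s₁ s₂)
      (show (c 0 : ℝ) - 36 * k ≤ c 0 - 12 * k by linarith) (show (c 1 : ℝ) - 36 * k ≤ c 1 + 36 * k by linarith)
      (isCompact_walkTrace σ) (isPreconnected_walkTrace σ)
      (fun z hz => by
        have := re_mem_Icc_of_mem_walkTrace σ (castT σ 0 hband) hz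
        push_cast at this; exact this)
      ⟨Site.toComplex zl, toComplex_mem_walkTrace σ hzl, by rw [Site.toComplex_im]; exact_mod_cast hzl'⟩
      ⟨Site.toComplex zr, toComplex_mem_walkTrace σ hzr, by rw [Site.toComplex_im]; exact_mod_cast hzr'⟩
      (isCompact_Icc.image hgfc) (isPreconnected_Icc.image _ hgfc.continuousOn)
      (by rintro _ ⟨s, hs, rfl⟩; exact hboxim _ (hpar_f s (hs₁.trans hs.1) (hs.2.trans hs₂)).1 (hpar_f s (hs₁.trans hs.1) (hs.2.trans hs₂)).2)
      ⟨gf s₂, ⟨s₂, right_mem_Icc.2 hs₁₂.le, rfl⟩, hlev₂.le⟩ ⟨gf s₁, ⟨s₁, left_mem_Icc.2 hs₁₂.le, rfl⟩, hlev₁.ge⟩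
    obtain ⟨s, -, rfl⟩ := hqH
    exact key σ hlen _ hqV

/-! ### The one-annulus estimate for the edge-killed walk -/

/-- **One-scale weak Beurling for the edge-killed walk, at every scale.** Let `p ∈ ∂D` lie in the
open box of radius `12k` about `c` on the mesh `δℤ²` (`|p/δ - c|_∞ < 12k`, `k ≥ 1`). Then for
every site `x` of the closed box of radius `12k` about `c`, the probability that the edge-killed walk
`Ω^δ` started at `x` leaves the box of radius `48k` alive is at most `1 - maneuverConst`:
`killedHarmExt (discreteDomainGraph D δ) (mW c k) 1 x ≤ 1 - c_*`.
[cite: Smirnov2010, Lemma B.2; Chelkak2016, Lemma 2.11] -/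
theorem _root_.Literature.Probability.RandomPlanarGeometry.JordanDomain.edgeKilled_survive_le (hδ : 0 < δ)
    {c : Site 2} {k : ℕ} (hk : 0 < k) {p : ℂ} (hp : p ∈ frontier D.carrier)
    (hp0 : |p.re / δ - c 0| < 12 * k) (hp1 : |p.im / δ - c 1| < 12 * k) {x : Site 2} (hx : x ∈ mB c k) :
    edgeSurvive (discreteDomainGraph D.carrier δ) (mW c k) x ≤ 1 - maneuverConst := by
  set Gr := discreteDomainGraph D.carrier δ
  have hIII := chainM_sub_chainNE_le (Gr := Gr) (U := mU c k) (L := mL c k) (n := 12) (mU_finite c k)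
    (mW_finite c k) mU_subset_mW 12 x
  have hII := maneuverConst_le_chainM hk hx (c := c)
  have hI : chainNE Gr (mU c k) (mL c k) 12 12 x = 0 := by
    by_contra hne
    have hpos : 0 < chainNE Gr (mU c k) (mL c k) 12 12 x :=
      lt_of_le_of_ne (chainNE_mem_Icc (mU_finite c k) 12 x).1 (Ne.symm hne)
    obtain ⟨hT, hR, hB, hL⟩ := exists_keptCrossings_of_chainNE_pos hk hx hpos
    exact D.false_of_keptCrossings hδ hk hp hp0 hp1 hT hR hB hL
  rw [hI, sub_zero] at hIII
  linarith

end Jordan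

end Literature.Probability.LatticeModels
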